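import Literature.NumberTheory.LFunctions.HarmonicSecondMomentCuspForms
import Literature.NumberTheory.EllipticCurves.NewformsFiniteProofs
import Literature.NumberTheory.EllipticCurves.NewformsOrthogonalBasisPrimeLevel
import HarnessLib

/-!
# The Bykovskii–Frolenkov second moment as a harmonic sum over newforms
# (`HarmonicSecondMomentCuspForms`, continued: proofs only)

Topic `Literature/NumberTheory/LFunctions` (namespace `Literature.NumberTheory.LFunctions`).
THEOREMS ONLY (no definition, no named fact; D-0026): a sibling of
`HarmonicSecondMomentCuspForms.lean` (Bykovskii–Frolenkov, Izv. Math. 81 (2017), Theorem 1.1 =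
named fact `bykovskiiFrolenkov2017_theorem11`), which puts Theorem 1.1 into the currency of the
tree's `IwaniecSarnak.harmonicSum N κ X = Σ_{f ∈ H_κ(N)} ω_f X_f` over the NEWFORMS
`H_κ(N) = newforms0 N κ` — the family of the Iwaniec–Sarnak programme (cell `landau-siegel`, §B-fam).

When the newforms of `S_κ(Γ₀(N))` are pairwise Petersson-orthogonal and span the whole space (no old
forms — e.g. `N` prime and `S_κ(Γ₀(1)) = 0`; the source notes this for prime `N` and
`2k ∈ {2,4,6,8,10,14}`, p0003:L82–L87 of `paper:arxiv-1608.00555`), they form an orthogonal basis of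
nonzero forms (`BykovskiiFrolenkov2017.isOrthogonalBasis_newforms`, using the tree's PROVED
`finite_newforms0_holds`), and `bykovskiiFrolenkov2017_theorem11.harmonic` (the orthogonal-basis form
proved in the sibling file) yields

* `bykovskiiFrolenkov2017_theorem11.harmonicSum` : for every `ε > 0` there is `C > 0` with
  `|Σ^h_{f ∈ H_{2k}(N)} |L_f(½+it)|² − W_{2k}(N;t) − (−1)^k δ_{1,N} U_{2k}(t)| ≤ C·((1+|t|)/(kN))·(kN(1+|t|))^ε`
  for all `k ≥ 1`, `N ≥ 1`, `t` (`t ≠ 0` if `N = 1`), CONDITIONAL on the two structural hypotheses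
  (orthogonality, spanning), which are carried explicitly;
* `bykovskiiFrolenkov2017_theorem11.harmonicSum_primeLevel` : the same UNCONDITIONALLY (modulo the
  named fact only) at PRIME level `N = p` and weight `2k < 12` — both hypotheses are tree theorems
  there: distinct newforms are Petersson-orthogonal (`newforms0_pairwise_orthogonal`, all levels)
  and there are no old forms (`span_newforms0_eq_top_of_prime`), file
  `EllipticCurves/NewformsOrthogonalBasisPrimeLevel.lean`. This is the family of the Iwaniec–Sarnak
  programme (prime level, weight 2).

## References

* [BykovskiiFrolenkov2017] Theorem 1.1 (p0003:L38–L50) and p0003:L82–L87 (prime level, no old forms).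
* [AtkinLehner1970] §4, Thm. 5 (newforms; tree `Newforms.lean`, `NewformsFiniteProofs.lean`).
* [IwaniecConversations2006] §7 (7.3) (the harmonic sum; tree `IwaniecSarnak.harmonicSum`).
-/

noncomputable section

open scoped MatrixGroups
open CongruenceSubgroup Complex Finset
open Literature.NumberTheory.EllipticCurves.ModularForms

namespace Literature.NumberTheory.LFunctions

open IwaniecSarnak BykovskiiFrolenkov2017

namespace BykovskiiFrolenkov2017

variable {N : ℕ} [NeZero N] {κ : ℤ}

/-- A newform is nonzero (it is normalised, `a_1 = 1`, while `a_1(0) = 0` by linearity of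
`f ↦ a_1(f)`: `L_{0·f} = 0·L_f`). [cite: AtkinLehner1970, §4 (newforms are normalised)] -/
theorem ne_zero_of_mem_newforms0 {f : CuspForm (Gamma0 N) κ} (hf : f ∈ newforms0 N κ) : f ≠ 0 := by
  have h1 : cuspCoeff f 1 = 1 := (isNormalized_iff_cuspCoeff_one f).mp hf.2.2
  intro h0
  -- `f = 0 = (0:ℂ) • f` would have `a_1 = 0 · a_1 = 0` (linearity of the `q`-expansion).
  have hsmul : (0 : ℂ) • f = f := by rw [zero_smul, h0]
  have key : cuspCoeff ((0 : ℂ) • f) 1 = 0 * cuspCoeff f 1 := by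
    have hΓ : (1 : ℝ) ∈ (Gamma0 N : Subgroup (GL (Fin 2) ℝ)).strictPeriods := by
      rw [strictPeriods_Gamma0]; exact AddSubgroup.mem_zmultiples 1
    change (UpperHalfPlane.qExpansion 1 ⇑((0 : ℂ) • f)).coeff 1 =
      0 * (UpperHalfPlane.qExpansion 1 ⇑f).coeff 1
    rw [CuspForm.IsGLPos.coe_smul, ModularForm.qExpansion_smul one_pos hΓ, map_smul, smul_eq_mul]
  rw [hsmul, zero_mul, h1] at key
  exact one_ne_zero key

/-- **Newforms as an orthogonal basis.** If the newforms of `S_κ(Γ₀(N))` are pairwise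
Petersson-orthogonal and span the whole space, the family of newforms (indexed by the finite set
`newforms0 N κ`, tree theorem `finite_newforms0_holds`) is an orthogonal basis of nonzero forms in
the sense of `BykovskiiFrolenkov2017.IsOrthogonalBasis`.
[cite: BykovskiiFrolenkov2017, §1 (p. 6, «ортогональный базис H*_{2k}(N)»)] -/
theorem isOrthogonalBasis_newforms
    (horth : ∀ f ∈ newforms0 N κ, ∀ g ∈ newforms0 N κ, f ≠ g →
      peterssonProduct (Gamma0 N) κ f g = 0)
    (hspan : ⊤ ≤ Submodule.span ℂ (newforms0 N κ)) :
    IsOrthogonalBasis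
      (fun f : ↥(finite_newforms0_holds N κ).toFinset => (f : CuspForm (Gamma0 N) κ)) := by
  have hmem : ∀ f : ↥(finite_newforms0_holds N κ).toFinset,
      (f : CuspForm (Gamma0 N) κ) ∈ newforms0 N κ := fun f =>
    (Set.Finite.mem_toFinset _).mp f.2
  refine ⟨fun i => ne_zero_of_mem_newforms0 (hmem i), fun i j hij =>
    horth _ (hmem i) _ (hmem j) (fun h => hij (Subtype.ext h)), ?_⟩
  refine le_trans hspan (Submodule.span_mono ?_)
  intro f hf
  exact ⟨⟨f, (Set.Finite.mem_toFinset _).mpr hf⟩, rfl⟩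

/-- The harmonic sum of the tree (`finsum` over `newforms0`) is the finite sum over the newform
family. [cite: IwaniecConversations2006, §7 (7.3)] -/
theorem harmonicSum_eq_sum_newforms (X : CuspForm (Gamma0 N) κ → ℝ) :
    harmonicSum N κ X =
      ∑ f : ↥(finite_newforms0_holds N κ).toFinset,
        harmonicWeight (f : CuspForm (Gamma0 N) κ) * X f := by
  unfold harmonicSum
  rw [finsum_mem_eq_finite_toFinset_sum _ (finite_newforms0_holds N κ), ← Finset.sum_coe_sort]

end BykovskiiFrolenkov2017

/-- **Theorem 1.1 as a harmonic sum over newforms** (conditional bridge, from the named fact): for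
every `ε > 0` there is `C > 0` such that for all `k ≥ 1`, `N ≥ 1`, `t` (`t ≠ 0` if `N = 1`), IF the
newforms `H_{2k}(N)` are pairwise Petersson-orthogonal and span `S_{2k}(Γ₀(N))` (no old forms), then
`|Σ^h_{f ∈ H_{2k}(N)} |L_f(½+it)|² − W_{2k}(N;t) − (−1)^k δ_{1,N} U_{2k}(t)| ≤ C·((1+|t|)/(kN))·(kN(1+|t|))^ε`,
`Σ^h = IwaniecSarnak.harmonicSum N (2k)` (weights `ω_f = Γ(2k−1)/((4π)^{2k−1}⟨f,f⟩)`). The two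
structural hypotheses are explicit; nothing is asserted about when they hold.
[cite: BykovskiiFrolenkov2017, Theorem 1.1 (p. 5–6, with p. 6 «при простом N … не существует старых форм»)] -/
theorem bykovskiiFrolenkov2017_theorem11.harmonicSum (h : bykovskiiFrolenkov2017_theorem11)
    {ε : ℝ} (hε : 0 < ε) :
    ∃ C : ℝ, 0 < C ∧ ∀ (k N : ℕ) [NeZero N] (t : ℝ), 1 ≤ k → (N = 1 → t ≠ 0) →
      (∀ f ∈ newforms0 N (2 * (k : ℤ)), ∀ g ∈ newforms0 N (2 * (k : ℤ)), f ≠ g →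
          peterssonProduct (Gamma0 N) (2 * (k : ℤ)) f g = 0) →
        ⊤ ≤ Submodule.span ℂ (newforms0 N (2 * (k : ℤ))) →
          ‖((harmonicSum N (2 * (k : ℤ)) (fun f => ‖analyticL f (1 / 2 + (t : ℂ) * I)‖ ^ 2) : ℝ) : ℂ) -
              mainTerm k N t‖ ≤ C * errorV1 ε k N t := by
  obtain ⟨C, hC, hmain⟩ := h.harmonic hε
  refine ⟨C, hC, fun k N _ t hk hNt horth hspan => ?_⟩
  have key := hmain k N t hk hNt _ (isOrthogonalBasis_newforms horth hspan)
  rw [harmonicSum_eq_sum_newforms]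
  exact key

/-- **Theorem 1.1 as a harmonic sum over newforms, prime level, weight `2k < 12` — unconditional
modulo the named fact.** For every `ε > 0` there is `C > 0` such that for every prime `p`, every
`k` with `1 ≤ k`, `2k < 12`, and every real `t`,
`|Σ^h_{f ∈ H_{2k}(p)} |L_f(½+it)|² − W_{2k}(p;t)| ≤ C·((1+|t|)/(kp))·(kp(1+|t|))^ε`
(`Σ^h = IwaniecSarnak.harmonicSum p (2k)`; `δ_{1,p} = 0`). The newforms of `S_{2k}(Γ₀(p))` are
pairwise orthogonal (`newforms0_pairwise_orthogonal`) and span (`span_newforms0_eq_top_of_prime`: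
no old forms since `S_{2k}(Γ₀(1)) = 0`), both PROVED in the tree — the source's remark
p0003:L82–L87 («при простом N и k ∈ {1,…,5,7} не существует старых форм») for `k ≤ 5`.
[cite: BykovskiiFrolenkov2017, Theorem 1.1 (p. 5–6) and p. 6 (prime level)] -/
theorem bykovskiiFrolenkov2017_theorem11.harmonicSum_primeLevel
    (h : bykovskiiFrolenkov2017_theorem11) {ε : ℝ} (hε : 0 < ε) :
    ∃ C : ℝ, 0 < C ∧ ∀ (k p : ℕ) [NeZero p] (t : ℝ), 1 ≤ k → 2 * (k : ℤ) < 12 → p.Prime →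
      ‖((IwaniecSarnak.harmonicSum p (2 * (k : ℤ))
            (fun f => ‖analyticL f (1 / 2 + (t : ℂ) * I)‖ ^ 2) : ℝ) : ℂ) -
          mainTermW k p t‖ ≤ C * errorV1 ε k p t := by
  obtain ⟨C, hC, hmain⟩ := h.harmonicSum hε
  refine ⟨C, hC, fun k p _ t hk hk12 hp => ?_⟩
  have hp1 : p ≠ 1 := hp.ne_one
  have key := hmain k p t hk (fun h1 => absurd h1 hp1) (newforms0_pairwise_orthogonal)
    (span_newforms0_eq_top_of_prime p (2 * (k : ℤ)) hp hk12).ge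
  have hmt : mainTerm k p t = mainTermW k p t := by
    unfold mainTerm
    rw [if_neg hp1, add_zero]
  rwa [hmt] at key

end Literature.NumberTheory.LFunctions

end
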